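import Mathlib
import Literature.MathematicalPhysics.QuantumFieldTheory.Balaban1983to89.TreeLengthTorus
import Literature.MathematicalPhysics.QuantumFieldTheory.Balaban1983to89.B13Closing

/-!
# `Balaban1983to89.TreeLengthTorusGeometry` — [Balaban1988RG2Cluster] (2.27) PROVED on the TORUS, the polymer
geometry of 𝐃_{k+1} (`B13Resummation.Geometry`) CONSTRUCTED on the papers' periodic carrier, and §2's closing chain
on the torus with no geometry hypothesis

CITATION HEADER (lean-in-tree rule 2026-08-18).  Sources under audit: T. Bałaban, *Renormalization group approach to
lattice gauge field theories. I*, Commun. Math. Phys. **109**, 249–301 (1987) [Balaban1987RG1] (cell paper B12;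
p. 251 = PDF p. 3, p. 257 = PDF p. 9); *II. Cluster expansions*, Commun. Math. Phys. **116**, 1–22 (1988)
[Balaban1988RG2Cluster] (cell paper B13; (2.11), (2.13) p. 14 = PDF p. 14, p. 15, (2.27)–(2.28) p. 18 = PDF p. 18,
pp. 20–22).  The two displayed sentences this module is about — (2.27) p. 18 and the definition of ζ after (2.11)
p. 14 — were re-read on the renders `1988-cmp116-rg-II-cluster-p018-x2.png`, `…-p014-x2.png` and are quoted below;
they, and everything else this module touches, are ALSO quoted verbatim in the docstrings of the imported modules
`…Balaban1983to89.TreeLength` (unit pv22: `cube`, `carrier`, `len`, `exists_wall_point`, `admissible_join_common`,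
`admissible_join_adj`, `exists_admissible_glue`, `treeLen_biUnion_add_two_le`, `ineq227_treeLen` — (2.27) for the
WINDOW model), `…Balaban1983to89.TreeLengthTorus` (unit pv22 gen 2: the periodic index model `TPt`, `proj`, `TAdj`,
`exists_lift_adj`, `TFaceConnected`, `exists_tfrontier`, `liftCubes`, `TAdmissible`, `torusTreeLen`,
`exists_tAdmissible`, `tsys`, `tcubeSys`, `tdegreeLE`, `tvolumeLeaf`), `…Balaban1983to89.TreeLengthCubeSystem`
(unit pv22: `Touch`, `reach`, `geometry` — the WINDOW instance of the polymer geometry), `…Balaban1983to89.B13Resummation`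
(unit pv18: `Geometry`, `SpRestr`, `Repr213`, `locE`, `cammarotaStepWith_of_KP`), `…Balaban1983to89.B13FamilySum`
(unit pv03: `Ineq126`, `VolBound`, `Ineq227`, `coveringFamilies`), `…Balaban1983to89.B12TreeDecay` (unit pv03:
`kappa₀`, `K₀`, `familySum_ineq126_of_volumeLeaf`, `familySum_volBound_iff`), `…Balaban1983to89.B13` (unit b13:
`prod_bound_228`, `StepData`, `Consts`, `Deliverables`, `LogHalfBound`, `Lemma3With`) and `…Balaban1983to89.B13Closing`
(unit b13 gen 3: `deliverables_of_KP_logHalf`, the window joiner `WindowStep` / `deliverables_window`).  Cell records: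
DIVERGENCE D-pv22.3 (window versus torus), D-pv22g2.1 (the covering-space reading of d_j; its clause «WHAT REMAINS OF
D-pv22.3: (2.27), coarsening/scale-transfer leaves, `B13Resummation.Geometry` window-only» is what this module reduces),
D-pv22.1 (conventions of the tree length, kept); GAPS.md G-B13-11 (the [26]-step, discharged in the kernel by unit pv18
modulo a `Geometry`), C-pv22-2, C-pv22-4, C-pv22g2-1, C-pv27-2; unit `b2b-balaban-pv22` gen 2 (surge node prover #22),
journal claim TORUS-GEOMETRY-KERNEL.  Nothing existing is modified.

WHAT THE PAPER PRINTS.  [Balaban1988RG2Cluster] p. 18, verbatim: *"Because ⋃_{Y∈𝐃} Y = Y₀ and Y₀ is a connected domain,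
hence the definition of d_k(Y) implies the inequality Σ_{Y∈𝐃} (d_k(Y) + 5) ≧ d_k(Y₀) + 5. (2.27)"*, followed by
*"Assuming 2E₀ε₁C₁α₄⁻¹α₆⁻¹M^q exp C₂κ₁ exp 5κ ≦ 1, we have Π_{Y∈𝐃} ⋯(in (2.26)) ≦ Π_{Y∈𝐃} α₆ exp(−δκd_k(Y)) ·
2E₀ε₁C₁α₄⁻¹α₆⁻¹M^q exp C₂κ₁ exp(−(1 − 4δ)κd_k(Y₀)). (2.28)"*; p. 14, verbatim: *"where the function ζ(Z, Z′) is defined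
by the condition: ζ(Z, Z′) = 0 if Z ∩ Z′ contains a cube, or a wall of a cube, and ζ(Z, Z′) = 1 otherwise."*  The
carrier is the TORUS of [Balaban1987RG1] p. 251, verbatim: *"a torus T obtained by the usual identification of boundary
points of the cube {x ∈ R^d : −L_μ ≦ x_μ ≦ L_μ, μ = 1, …, d}"*, with the localization domains and d_j of p. 257
(*"two consecutive cubes have a common wall"*, *"Consider a class of tree graphs contained in X and intersecting all
the cubes in X. A length of a shortest graph in this class, divided by M, is the linear size of X, and is denoted by
d_j(X)"*) — all as quoted in full in `…TreeLengthTorus`.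

WHAT IS PROVED HERE (kernel-checked; Mathlib + the imported cell modules only).  Part 1 — DECK TRANSFORMATIONS: the
translations z ↦ N·k + z (k ∈ ℤ^d) of the universal cover preserve carriers, lengths and torus-admissibility of
polygonal graphs (`tAdmissible_translate`), hence an admissible graph for X̄ can be RE-SHEETED so as to meet any
prescribed lift of any cube of X̄ at the same length (`exists_translate_meets`).  Part 2 — the two JOIN LEMMAS on the
torus: admissible graphs of Ā and B̄ sharing a cube glue at cost ≤ 1 (`tAdmissible_join_common`), sharing a wall ON
THE TORUS — wrap-around walls included, via `exists_lift_adj` + `TreeLength.exists_wall_point` — at cost ≤ 2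
(`tAdmissible_join_adj`).  Part 3 — **(2.27) ON THE TORUS, PROVED** for `torusTreeLen`: the gluing induction along
torus frontier walls (`exists_tAdmissible_glue`, `exists_tAdmissible_biUnion`), the sharpened form d_k(Ȳ₀) + 2 ≤
Σ_{Y∈𝐃}(d_k(Y) + 2) (`torusTreeLen_biUnion_add_two_le`), the PRINTED form with the constant 5 (`ineq227_torusTreeLen`)
and (2.27) ⇒ (2.28) by unit b13's `prod_bound_228` (`prod_bound_228_torusTreeLen`) — for every non-empty finite family
𝐃 of torus localization domains whose union is a torus localization domain.  Part 4 — **THE POLYMER GEOMETRY OF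
𝐃_{k+1} ON THE TORUS, CONSTRUCTED**: the incompatibility of (2.11) on the torus `TTouch` (share a cube or a torus
wall; reflexive, symmetric), the reach `treach` with #treach Z ≤ (2d + 1)·#Z (`card_treach_le`, from `tdegreeLE`),
(2.27) with constant 5 for the covering families of the torus catalogue (`ineq227_tcubes`), and the structure
`tgeometry d N : B13Resummation.Geometry (tsys d N) (TPt d N)` with ALL fields PROVED — (1.26) at rate κ₀(4·2^d, 2d)
with constant K₀(4·2^d, 2d) (unit pv03's `familySum_ineq126_of_volumeLeaf` on `tdegreeLE`, `tvolumeLeaf`), the additive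
volume bound with c₁ = 4·2^d, (2.27) — same dimension-only constants as the window instance
`TreeLengthCubeSystem.geometry` (`tgeometry_consts`, `tgeometry_consts_four`: d = 4 gives ν = 9, κ₀ = 64 log 162,
c₁ = 64).  Part 5 — **§2's CLOSING CHAIN ON THE TORUS with no geometry hypothesis**: step data whose 𝐃_{k+1} IS the
periodic system (`TorusStep d N`, `toStepData` with `Dk1 := tsys d N`, `geom := tgeometry d N`), the restriction
property of the spaces p. 15 and the representation (2.13) in their concrete torus form (`TorusStep.spRestr`,
`TorusStep.repr213`), and `deliverables_torus` / `deliverables_torus_four` = unit b13 gen 3's generic joiner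
`B13Closing.deliverables_of_KP_logHalf` at G := `tgeometry d N`: Theorem I.3's delivered clauses for A_{k+1}
(`B13.Deliverables`) on the PERIODIC CARRIER from exactly the hypotheses of `B13Closing.deliverables_window` (the
restrictions, Lemma 3_ℓ, p. 15, (2.13), the UNPRINTED per-cube log Z^{(k)} leaf, (I.1.7)/analyticity/gauge invariance,
and the numbers), (1.26), (2.27), (2.29)/(2.30) being THEOREMS for `torusTreeLen` and the [26]-step a THEOREM from
Kotecký–Preiss.

WHAT IS *NOT* CLAIMED.  (i) As in `…TreeLengthTorus`: the identification of `torusTreeLen` with the printed d_j rests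
on the covering-space READING D-pv22g2.1 (graphs handled in the universal cover ℝ^d; a tree of the torus lifts
isometrically, a connected graph of ℝ^d projects without increasing length) and on conventions (i)–(iii) of D-pv22.1;
in that reading the re-sheeting of Part 1 is invisible on the torus (two lifts of one graph) and the joins of Part 2
project to the joins the paper has in mind.  (ii) The coarsening / scale-transfer leaves of `…B13ScaleTransfer` and
`…TreeLength` Parts 3, 5–7 (exact coarsening `coarseningLeaf_treeLen`, capture, the Steiner-length leaves of the
(2.36) substitute) are NOT redone on the torus (a scale transfer by L on the torus needs L ∣ N; they stay proved for
the window / ℤ^d model only) — after this module that is ALL that remains of DIVERGENCE D-pv22.3.  (iii) Part 5 is a joiner: every analytic hypothesis of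
`B13Closing.deliverables_window` is kept verbatim (only the carrier changes); in particular the per-cube log Z^{(k)}
leaf is UNPRINTED (cell GAPS G-adv5-5 / G-B13-12a) and Lemma 3_ℓ, the restrictions, (I.1.7) are hypotheses.  (iv) For
N = 1, 2 the torus adjacency degenerates; all statements remain true as stated.  Value = kernel-checked bookkeeping
((2.27) and the G-B13-11 polymer geometry on the periodic carrier; reduces DIVERGENCE D-pv22.3 to the scale-transfer
leaves), NOT summit progress.
-/

namespace Literature.MathematicalPhysics.QuantumFieldTheory.Balaban1983to89.TreeLengthTorusGeometry

noncomputable section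

open Literature.MathematicalPhysics.QuantumFieldTheory.Balaban1983to89
open Literature.MathematicalPhysics.QuantumFieldTheory.Balaban1983to89.B13ScaleTransfer
open Literature.MathematicalPhysics.QuantumFieldTheory.Balaban1983to89.TreeLength
open Literature.MathematicalPhysics.QuantumFieldTheory.Balaban1983to89.B12TreeDecay
open Literature.MathematicalPhysics.QuantumFieldTheory.Balaban1983to89.TreeLengthTorus
open Literature.MathematicalPhysics.QuantumFieldTheory.Balaban1983to89.B13
open Literature.MathematicalPhysics.QuantumFieldTheory.Balaban1983to89.B13Resummation
open Literature.MathematicalPhysics.QuantumFieldTheory.Balaban1983to89.B13Closing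

variable {d : ℕ} {N : ℕ}

/-! ## Part 1. Deck transformations: translations of ℝ^d by the periods N·k, k ∈ ℤ^d -/

/-- The period vector N·k ∈ Nℤ^d of the covering ℝ^d → ℝ^d/Nℤ^d ([Balaban1987RG1] p. 251: the torus *"obtained by
the usual identification of boundary points of the cube"*). [cite: Balaban1987RG1, p.251 (torus)] -/
def period (N : ℕ) (k : Pt d) : Pt d := fun i => (N : ℤ) * k i

/-- Translating a cube index by a period does not change its class on the torus. [folklore] -/
theorem proj_add_period (x k : Pt d) : proj N (x + period N k) = proj N x := by
  funext i
  simp [proj, period, Int.cast_mul]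

/-- Two cube indices with the same class on the torus differ by a period. [folklore] -/
theorem exists_period_of_proj_eq {x y : Pt d} (h : proj N x = proj N y) : ∃ k : Pt d, y = x + period N k := by
  have hi : ∀ i, ∃ c : ℤ, y i - x i = (N : ℤ) * c := by
    intro i
    have h1 : ((x i : ℤ) : ZMod N) = ((y i : ℤ) : ZMod N) := by
      have := congrFun h i
      simpa [proj] using this
    obtain ⟨c, hc⟩ := (ZMod.intCast_eq_intCast_iff_dvd_sub (x i) (y i) N).1 h1
    exact ⟨c, hc⟩
  choose k hk using hi
  refine ⟨k, funext fun i => ?_⟩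
  have := hk i
  simp only [Pi.add_apply, period]
  linarith

/-- Translation of a segment by the vector v. [folklore] -/
def transSeg (v : RPt d) (s : Seg d) : Seg d := (v + s.1, v + s.2)

/-- A translation maps segments onto segments. [folklore] -/
theorem image_add_segment (v p q : RPt d) :
    (fun z : RPt d => v + z) '' segment ℝ p q = segment ℝ (v + p) (v + q) :=
  segment_translate_image ℝ v p q

/-- Carrier of a translated graph = translated carrier. [folklore] -/
theorem carrier_map_transSeg (v : RPt d) (T : List (Seg d)) :
    carrier (T.map (transSeg v)) = (fun z : RPt d => v + z) '' carrier T := by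
  induction T with
  | nil => simp
  | cons s T ih =>
    rw [List.map_cons, carrier_cons, carrier_cons, Set.image_union, image_add_segment, ih]
    rfl

/-- A translation preserves the length of a graph. [folklore] -/
theorem len_map_transSeg (v : RPt d) (T : List (Seg d)) : len (T.map (transSeg v)) = len T := by
  induction T with
  | nil => simp
  | cons s T ih =>
    rw [List.map_cons, len_cons, len_cons, ih]
    change dist (v + s.1) (v + s.2) + len T = dist s.1 s.2 + len T
    rw [dist_add_left]

/-- Translating by the corner vector of k ∈ ℤ^d maps the cube of index x onto the cube of index k + x. [folklore] -/
theorem add_mem_cube {x k : Pt d} {p : RPt d} (hp : p ∈ cube x) : corner k + p ∈ cube (k + x) := by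
  rw [mem_cube] at hp ⊢
  intro i
  have h := hp i
  simp only [Pi.add_apply, corner, Int.cast_add]
  constructor <;> linarith [h.1, h.2]

/-- π⁻¹(X̄) is invariant under the deck transformations z ↦ N·k + z. [folklore] -/
theorem add_mem_liftCubes {X : Finset (TPt d N)} (k : Pt d) {p : RPt d} (hp : p ∈ liftCubes X) :
    corner (period N k) + p ∈ liftCubes X := by
  obtain ⟨x, hx, hpx⟩ := mem_liftCubes.1 hp
  refine mem_liftCubes.2 ⟨period N k + x, ?_, add_mem_cube hpx⟩
  rwa [add_comm, proj_add_period]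

/-- `liftCubes` is monotone. [folklore] -/
theorem liftCubes_mono {X Y : Finset (TPt d N)} (h : X ⊆ Y) : liftCubes X ⊆ liftCubes Y := by
  intro p hp
  obtain ⟨x, hx, hpx⟩ := mem_liftCubes.1 hp
  exact mem_liftCubes.2 ⟨x, h hx, hpx⟩

/-- A cube whose index projects into X̄ lies in π⁻¹(X̄). [folklore] -/
theorem cube_subset_liftCubes {X : Finset (TPt d N)} {x : Pt d} (hx : proj N x ∈ X) : cube x ⊆ liftCubes X :=
  fun _ hp => mem_liftCubes.2 ⟨x, hx, hp⟩

/-- A torus family with an admissible graph is non-empty. [folklore] -/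
theorem finset_nonempty_of_tAdmissible {X : Finset (TPt d N)} {T : List (Seg d)} (h : TAdmissible X T) :
    X.Nonempty := by
  obtain ⟨p, hp⟩ := h.connected.nonempty
  obtain ⟨x, hx, -⟩ := mem_liftCubes.1 (h.subset hp)
  exact ⟨proj N x, hx⟩

/-- DECK INVARIANCE OF ADMISSIBILITY: a deck-translate of a graph admissible for X̄ (torus sense, in the universal
cover) is admissible for X̄ — it is another lift of the same graph of the torus. [cite: Balaban1987RG1, p.257 (linear size d_j)] -/
theorem tAdmissible_translate {X : Finset (TPt d N)} {T : List (Seg d)} (hT : TAdmissible X T) (k : Pt d) :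
    TAdmissible X (T.map (transSeg (corner (period N k)))) := by
  have hc : Continuous fun z : RPt d => corner (period N k) + z := continuous_const.add continuous_id
  refine ⟨?_, ?_, ?_⟩
  · rw [carrier_map_transSeg]
    exact hT.connected.image _ hc.continuousOn
  · rw [carrier_map_transSeg]
    rintro _ ⟨z, hz, rfl⟩
    exact add_mem_liftCubes k (hT.subset hz)
  · intro a ha
    obtain ⟨x, hxa, q, hqT, hqx⟩ := hT.meets a ha
    refine ⟨period N k + x, ?_, corner (period N k) + q, ?_, add_mem_cube hqx⟩
    · rw [add_comm, proj_add_period, hxa]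
    · rw [carrier_map_transSeg]
      exact Set.mem_image_of_mem _ hqT

/-- RE-SHEETING: if T is admissible for X̄ and x is ANY lift of a cube □ of X̄, some deck-translate of T (same length,
still admissible for X̄) meets the cube x itself. [cite: Balaban1987RG1, p.257 (linear size d_j)] -/
theorem exists_translate_meets {X : Finset (TPt d N)} {T : List (Seg d)} (hT : TAdmissible X T) {a : TPt d N}
    (ha : a ∈ X) {x : Pt d} (hx : proj N x = a) :
    ∃ T', TAdmissible X T' ∧ len T' = len T ∧ (carrier T' ∩ cube x).Nonempty := by
  obtain ⟨x', hx'a, q, hqT, hqx'⟩ := hT.meets a ha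
  obtain ⟨k, hk⟩ := exists_period_of_proj_eq (hx'a.trans hx.symm)
  refine ⟨T.map (transSeg (corner (period N k))), tAdmissible_translate hT k, len_map_transSeg _ _,
    corner (period N k) + q, ?_, ?_⟩
  · rw [carrier_map_transSeg]
    exact Set.mem_image_of_mem _ hqT
  · rw [hk, add_comm x' (period N k)]
    exact add_mem_cube hqx'

/-! ## Part 2. Joining admissible graphs of two torus families through a common cube or a common wall -/

/-- JOIN THROUGH A COMMON CUBE, on the torus: admissible graphs for Ā and for B̄ with a common cube □ glue — after
re-sheeting the graph of B̄ so that both meet the SAME lift of □ — to an admissible graph for B̄ ∪ Ā at cost ≤ 1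
(a segment inside that lift).  The window version is `TreeLength.admissible_join_common`. [cite: Balaban1988RG2Cluster, (2.27) p.18] -/
theorem tAdmissible_join_common {A B : Finset (TPt d N)} {TA TB : List (Seg d)} (hA : TAdmissible A TA)
    (hB : TAdmissible B TB) {c : TPt d N} (hcA : c ∈ A) (hcB : c ∈ B) :
    ∃ T, TAdmissible (B ∪ A) T ∧ len T ≤ len TB + len TA + 1 := by
  obtain ⟨x, hxc, p, hpT, hpx⟩ := hA.meets c hcA
  obtain ⟨TB', hB', hlenB, q, hqT, hqx⟩ := exists_translate_meets hB hcB hxc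
  refine ⟨TB' ++ ((q, p) :: TA), ⟨?_, ?_, ?_⟩, ?_⟩
  · rw [carrier_append, carrier_cons]
    refine IsConnected.union ⟨q, hqT, Set.mem_union_left _ (left_mem_segment ℝ q p)⟩ hB'.connected ?_
    exact IsConnected.union ⟨p, right_mem_segment ℝ q p, hpT⟩
      ((convex_segment q p).isConnected ⟨q, left_mem_segment ℝ q p⟩) hA.connected
  · rw [carrier_append, carrier_cons]
    refine Set.union_subset (hB'.subset.trans (liftCubes_mono Finset.subset_union_left)) (Set.union_subset ?_
      (hA.subset.trans (liftCubes_mono Finset.subset_union_right)))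
    refine ((convex_cube x).segment_subset hqx hpx).trans (cube_subset_liftCubes ?_)
    rw [hxc]
    exact Finset.mem_union_right _ hcA
  · intro a ha
    rw [carrier_append, carrier_cons]
    rcases Finset.mem_union.1 ha with ha | ha
    · obtain ⟨y, hy, r, hr, hry⟩ := hB'.meets a ha
      exact ⟨y, hy, r, Set.mem_union_left _ hr, hry⟩
    · obtain ⟨y, hy, r, hr, hry⟩ := hA.meets a ha
      exact ⟨y, hy, r, Set.mem_union_right _ (Set.mem_union_right _ hr), hry⟩
  · rw [len_append, len_cons, hlenB]
    change len TB + (dist q p + len TA) ≤ len TB + len TA + 1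
    linarith [dist_le_one_of_mem_cube hqx hpx]

/-- JOIN THROUGH ADJACENT CUBES, on the torus (wrap-around walls included): admissible graphs for Ā and for B̄, with a
cube ā of Ā having a common wall ON THE TORUS with a cube c̄ of B̄, glue to an admissible graph for B̄ ∪ Ā at cost
≤ 2 — lift the wall to ℤ^d next to the met lift of ā (`exists_lift_adj`), re-sheet the graph of B̄ to that lift of
c̄, then a segment inside the lift of ā to the common wall (`TreeLength.exists_wall_point`) and a segment inside the
lift of c̄.  Window version: `TreeLength.admissible_join_adj`. [cite: Balaban1988RG2Cluster, (2.27) p.18] -/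
theorem tAdmissible_join_adj {A B : Finset (TPt d N)} {TA TB : List (Seg d)} (hA : TAdmissible A TA)
    (hB : TAdmissible B TB) {a c : TPt d N} (haA : a ∈ A) (hcB : c ∈ B) (hac : TAdj a c) :
    ∃ T, TAdmissible (B ∪ A) T ∧ len T ≤ len TB + len TA + 2 := by
  obtain ⟨xa, hxa, p, hpT, hpa⟩ := hA.meets a haA
  rw [← hxa] at hac
  obtain ⟨y, hyc, hadj⟩ := exists_lift_adj hac
  obtain ⟨TB', hB', hlenB, q, hqT, hqy⟩ := exists_translate_meets hB hcB hyc
  obtain ⟨w, hwa, hwy, -⟩ := exists_wall_point hadj hpa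
  refine ⟨TB' ++ ((q, w) :: (w, p) :: TA), ⟨?_, ?_, ?_⟩, ?_⟩
  · rw [carrier_append, carrier_cons, carrier_cons]
    have h3 : IsConnected (segment ℝ w p ∪ carrier TA) :=
      IsConnected.union ⟨p, right_mem_segment ℝ w p, hpT⟩
        ((convex_segment w p).isConnected ⟨w, left_mem_segment ℝ w p⟩) hA.connected
    have h2 : IsConnected (segment ℝ q w ∪ (segment ℝ w p ∪ carrier TA)) :=
      IsConnected.union ⟨w, right_mem_segment ℝ q w, Set.mem_union_left _ (left_mem_segment ℝ w p)⟩
        ((convex_segment q w).isConnected ⟨q, left_mem_segment ℝ q w⟩) h3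
    exact IsConnected.union ⟨q, hqT, Set.mem_union_left _ (left_mem_segment ℝ q w)⟩ hB'.connected h2
  · rw [carrier_append, carrier_cons, carrier_cons]
    refine Set.union_subset (hB'.subset.trans (liftCubes_mono Finset.subset_union_left))
      (Set.union_subset ?_ (Set.union_subset ?_ (hA.subset.trans (liftCubes_mono Finset.subset_union_right))))
    · refine ((convex_cube y).segment_subset hqy hwy).trans (cube_subset_liftCubes ?_)
      rw [hyc]
      exact Finset.mem_union_left _ hcB
    · refine ((convex_cube xa).segment_subset hwa hpa).trans (cube_subset_liftCubes ?_)
      rw [hxa]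
      exact Finset.mem_union_right _ haA
  · intro b hb
    rw [carrier_append, carrier_cons, carrier_cons]
    rcases Finset.mem_union.1 hb with hb | hb
    · obtain ⟨z, hz, r, hr, hrz⟩ := hB'.meets b hb
      exact ⟨z, hz, r, Set.mem_union_left _ hr, hrz⟩
    · obtain ⟨z, hz, r, hr, hrz⟩ := hA.meets b hb
      exact ⟨z, hz, r, Set.mem_union_right _ (Set.mem_union_right _ (Set.mem_union_right _ hr)), hrz⟩
  · rw [len_append, len_cons, len_cons, hlenB]
    change len TB + (dist q w + (dist w p + len TA)) ≤ len TB + len TA + 2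
    linarith [dist_le_one_of_mem_cube hqy hwy, dist_le_one_of_mem_cube hwa hpa]

/-! ## Part 3. [Balaban1988RG2Cluster] (2.27) on the torus: gluing the graphs of a family with connected union -/

/-- GLUING INDUCTION for (2.27) on the torus — the port of `TreeLength.exists_admissible_glue` with frontier walls
taken ON THE TORUS (`exists_tfrontier`) and the two torus join lemmas. [cite: Balaban1988RG2Cluster, (2.27) p.18] -/
theorem exists_tAdmissible_glue {D : Finset (Finset (TPt d N))} (hU : TFaceConnected (D.biUnion id))
    {f : Finset (TPt d N) → List (Seg d)} (hf : ∀ Y ∈ D, TAdmissible Y (f Y)) :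
    ∀ n : ℕ, ∀ G : Finset (Finset (TPt d N)), G ⊆ D → G.Nonempty → (D \ G).card = n →
      (∃ T, TAdmissible (G.biUnion id) T ∧ len T ≤ ∑ Y ∈ G, len (f Y) + 2 * ((G.card : ℝ) - 1)) →
      ∃ T, TAdmissible (D.biUnion id) T ∧ len T ≤ ∑ Y ∈ D, len (f Y) + 2 * ((D.card : ℝ) - 1) := by
  intro n
  induction n with
  | zero =>
    intro G hGD _ hcard hT
    have hGeq : G = D :=
      Finset.Subset.antisymm hGD (Finset.sdiff_eq_empty_iff_subset.1 (Finset.card_eq_zero.1 hcard))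
    subst hGeq
    exact hT
  | succ n ih =>
    intro G hGD hGne hcard hT
    obtain ⟨T, hT, hlen⟩ := hT
    obtain ⟨Y', hY'D, hY'G, T₁, hT₁, hlen₁⟩ : ∃ Y' ∈ D, Y' ∉ G ∧
        ∃ T₁, TAdmissible (Y' ∪ G.biUnion id) T₁ ∧ len T₁ ≤ len (f Y') + len T + 2 := by
      by_cases hmeet : ∃ Y' ∈ D, Y' ∉ G ∧ ∃ c ∈ Y', c ∈ G.biUnion id
      · obtain ⟨Y', hY'D, hY'G, c, hcY', hcA⟩ := hmeet
        obtain ⟨T₁, hT₁, hlen₁⟩ := tAdmissible_join_common hT (hf Y' hY'D) hcA hcY'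
        exact ⟨Y', hY'D, hY'G, T₁, hT₁, by linarith⟩
      · push Not at hmeet
        have hne : (D \ G).Nonempty := by
          rw [← Finset.card_pos, hcard]
          exact Nat.succ_pos n
        obtain ⟨Y'', hY''⟩ := hne
        rw [Finset.mem_sdiff] at hY''
        obtain ⟨y, hy⟩ := finset_nonempty_of_tAdmissible (hf Y'' hY''.1)
        have hyU : y ∈ D.biUnion id := Finset.mem_biUnion.2 ⟨Y'', hY''.1, hy⟩
        have hyA : y ∉ G.biUnion id := hmeet Y'' hY''.1 hY''.2 y hy
        have hAU : G.biUnion id ⊆ D.biUnion id := Finset.biUnion_subset_biUnion_of_subset_left _ hGD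
        obtain ⟨Y₁, hY₁⟩ := hGne
        obtain ⟨x₀, hx₀⟩ := finset_nonempty_of_tAdmissible (hf Y₁ (hGD hY₁))
        have hx₀A : x₀ ∈ G.biUnion id := Finset.mem_biUnion.2 ⟨Y₁, hY₁, hx₀⟩
        obtain ⟨a, haA, c, hcU, hcA, hac⟩ := exists_tfrontier hAU hU hx₀A hyU hyA
        obtain ⟨Y', hY'D, hcY'⟩ := Finset.mem_biUnion.1 hcU
        have hY'G : Y' ∉ G := fun h => hcA (Finset.mem_biUnion.2 ⟨Y', h, hcY'⟩)
        obtain ⟨T₁, hT₁, hlen₁⟩ := tAdmissible_join_adj hT (hf Y' hY'D) haA hcY' hac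
        exact ⟨Y', hY'D, hY'G, T₁, hT₁, by linarith⟩
    have hsub : insert Y' G ⊆ D := Finset.insert_subset hY'D hGD
    have hcard' : (D \ insert Y' G).card = n := by
      rw [Finset.sdiff_insert, Finset.card_erase_of_mem (Finset.mem_sdiff.2 ⟨hY'D, hY'G⟩), hcard]
      simp
    refine ih (insert Y' G) hsub (Finset.insert_nonempty _ _) hcard' ⟨T₁, ?_, ?_⟩
    · rw [Finset.biUnion_insert]
      exact hT₁
    · rw [Finset.sum_insert hY'G, Finset.card_insert_of_notMem hY'G]
      push_cast
      linarith

/-- (2.27) on the torus, graph form: admissible graphs `f Y` of the members of a non-empty finite family 𝐃 of torus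
families with torus-face-connected union Ȳ₀ glue to an admissible graph for Ȳ₀ of length ≤ Σ_{Y∈𝐃} len(f Y) +
2(|𝐃| − 1). [cite: Balaban1988RG2Cluster, (2.27) p.18] -/
theorem exists_tAdmissible_biUnion {D : Finset (Finset (TPt d N))} (hD : D.Nonempty)
    (hU : TFaceConnected (D.biUnion id)) {f : Finset (TPt d N) → List (Seg d)}
    (hf : ∀ Y ∈ D, TAdmissible Y (f Y)) :
    ∃ T, TAdmissible (D.biUnion id) T ∧ len T ≤ ∑ Y ∈ D, len (f Y) + 2 * ((D.card : ℝ) - 1) := by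
  obtain ⟨Y₁, hY₁⟩ := hD
  refine exists_tAdmissible_glue hU hf _ {Y₁} (Finset.singleton_subset_iff.2 hY₁) (Finset.singleton_nonempty _)
    rfl ⟨f Y₁, ?_, ?_⟩
  · rw [Finset.singleton_biUnion]
    exact hf Y₁ hY₁
  · simp

/-- Near-optimal admissible graphs on the torus: for every ε > 0 there is one of length < d_j(X̄) + ε. [folklore] -/
theorem exists_tAdmissible_len_lt {X : Finset (TPt d N)} (hne : ∃ T, TAdmissible X T) {ε : ℝ} (hε : 0 < ε) :
    ∃ T, TAdmissible X T ∧ len T < torusTreeLen X + ε := by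
  obtain ⟨T₀, hT₀⟩ := hne
  obtain ⟨ℓ, ⟨T, hT, rfl⟩, hlt⟩ :=
    exists_lt_of_csInf_lt (s := tlengths X) ⟨len T₀, T₀, hT₀, rfl⟩ (lt_add_of_pos_right _ hε)
  exact ⟨T, hT, hlt⟩

section Periodic

variable [NeZero N]

/-- (2.27) SHARPENED, PROVED ON THE TORUS: for a non-empty finite family 𝐃 of torus localization domains whose union
Ȳ₀ is a torus localization domain, d_k(Ȳ₀) + 2 ≤ Σ_{Y∈𝐃} (d_k(Y) + 2) — [Balaban1988RG2Cluster] p. 18: *"Because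
⋃_{Y∈𝐃} Y = Y₀ and Y₀ is a connected domain, hence the definition of d_k(Y) implies the inequality"* (printed with
the constant 5, `ineq227_torusTreeLen`); window version `TreeLength.treeLen_biUnion_add_two_le`. [cite: Balaban1988RG2Cluster, (2.27) p.18] -/
theorem torusTreeLen_biUnion_add_two_le {D : Finset (Finset (TPt d N))} (hD : D.Nonempty)
    (hmem : ∀ Y ∈ D, Y.Nonempty ∧ TFaceConnected Y) (hU : TFaceConnected (D.biUnion id)) :
    torusTreeLen (D.biUnion id) + 2 ≤ ∑ Y ∈ D, (torusTreeLen Y + 2) := by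
  refine le_of_forall_pos_le_add fun ε hε => ?_
  have hDpos : (0 : ℝ) < D.card := by exact_mod_cast Finset.card_pos.2 hD
  obtain ⟨δ, hδpos, hδ⟩ : ∃ δ : ℝ, 0 < δ ∧ (D.card : ℝ) * δ = ε :=
    ⟨ε / D.card, div_pos hε hDpos, by field_simp⟩
  have hch : ∀ Y ∈ D, ∃ T, TAdmissible Y T ∧ len T < torusTreeLen Y + δ := by
    intro Y hY
    have hne : ∃ T, TAdmissible Y T := by
      obtain ⟨T, hT, -⟩ := exists_tAdmissible (hmem Y hY).1 (hmem Y hY).2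
      exact ⟨T, hT⟩
    exact exists_tAdmissible_len_lt hne hδpos
  choose! f hf hflen using hch
  obtain ⟨T, hT, hlen⟩ := exists_tAdmissible_biUnion hD hU hf
  have h1 := torusTreeLen_le_len hT
  have h2 : ∑ Y ∈ D, len (f Y) ≤ ∑ Y ∈ D, (torusTreeLen Y + δ) :=
    Finset.sum_le_sum fun Y hY => (hflen Y hY).le
  rw [Finset.sum_add_distrib, Finset.sum_const, nsmul_eq_mul] at h2
  rw [Finset.sum_add_distrib, Finset.sum_const, nsmul_eq_mul]
  linarith

/-- **(2.27) AS PRINTED, PROVED ON THE TORUS**, verbatim: *"Σ_{Y∈𝐃} (d_k(Y) + 5) ≧ d_k(Y₀) + 5. (2.27)"* — for a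
non-empty finite family 𝐃 of torus localization domains with ⋃_{Y∈𝐃} Y = Ȳ₀ a torus localization domain, d_k :=
`torusTreeLen`; window version `TreeLength.ineq227_treeLen`. [cite: Balaban1988RG2Cluster, (2.27) p.18] -/
theorem ineq227_torusTreeLen {D : Finset (Finset (TPt d N))} (hD : D.Nonempty)
    (hmem : ∀ Y ∈ D, Y.Nonempty ∧ TFaceConnected Y) (hU : TFaceConnected (D.biUnion id)) :
    torusTreeLen (D.biUnion id) + 5 ≤ ∑ Y ∈ D, (torusTreeLen Y + 5) := by
  have h := torusTreeLen_biUnion_add_two_le hD hmem hU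
  have hD1 : (1 : ℝ) ≤ D.card := by
    have h0 : 1 ≤ D.card := Finset.card_pos.2 hD
    exact_mod_cast h0
  rw [Finset.sum_add_distrib, Finset.sum_const, nsmul_eq_mul] at h ⊢
  linarith

/-- (2.27) ⇒ (2.28) on the torus: `B13.prod_bound_228` (unit b13: the product bound (2.28) p. 18 from an abstract
(2.27)-type hypothesis) with d := `torusTreeLen` — the hypothesis is now the THEOREM `ineq227_torusTreeLen`; window
version `TreeLength.prod_bound_228_treeLen`. [cite: Balaban1988RG2Cluster, (2.27)–(2.28) p.18] -/
theorem prod_bound_228_torusTreeLen {D : Finset (Finset (TPt d N))} (hD : D.Nonempty)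
    (hmem : ∀ Y ∈ D, Y.Nonempty ∧ TFaceConnected Y) (hU : TFaceConnected (D.biUnion id)) (A r r' : ℝ)
    (hA : 0 ≤ A) (hr : 0 ≤ r) (hrr : r ≤ r') (hsmall : A * Real.exp (5 * r') ≤ 1) :
    ∏ Y ∈ D, (A * Real.exp (-(r * torusTreeLen Y))) ≤ A * Real.exp (-(r * torusTreeLen (D.biUnion id))) :=
  B13.prod_bound_228 D hD torusTreeLen A r r' (torusTreeLen (D.biUnion id)) hA hr hrr hsmall
    (ineq227_torusTreeLen hD hmem hU)

/-! ## Part 4. The polymer-geometry structure of `B13Resummation` (G-B13-11 kernel), CONSTRUCTED on the torus -/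

/-- The incompatibility of the polymer gas (2.11) on the torus: *"ζ(Z, Z′) = 0 if Z ∩ Z′ contains a cube, or a wall of
a cube"* (as quoted in `B13Resummation.Geometry`) — the two domains share a cube or a pair of cubes with a common wall
ON THE TORUS (wrap-around walls included); window version `TreeLengthCubeSystem.Touch`. [cite: Balaban1988RG2Cluster, (2.11) p.14] -/
def TTouch (Z Z' : TDom d N) : Prop :=
  ∃ a ∈ Z.1, ∃ b ∈ Z'.1, a = b ∨ TAdj a b

/-- `TTouch` is reflexive (a domain has a cube). [folklore] -/
theorem ttouch_refl (Z : TDom d N) : TTouch Z Z := by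
  obtain ⟨a, ha⟩ := Z.2.1
  exact ⟨a, ha, a, ha, Or.inl rfl⟩

/-- `TTouch` is symmetric. [folklore] -/
theorem ttouch_symm (Z Z' : TDom d N) (h : TTouch Z Z') : TTouch Z' Z := by
  obtain ⟨a, ha, b, hb, hab⟩ := h
  refine ⟨b, hb, a, ha, ?_⟩
  rcases hab with hab | hab
  · exact Or.inl hab.symm
  · exact Or.inr hab.symm

/-- The reach of a torus domain: its cubes and the cubes of the torus sharing a wall with one of them; window version
`TreeLengthCubeSystem.reach`. [cite: Balaban1988RG2Cluster, (2.11) p.14] -/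
def treach (Z : TDom d N) : Finset (TPt d N) := by
  classical
  exact Finset.univ.filter fun q => ∃ a ∈ Z.1, q = a ∨ TAdj a q

/-- Membership in `treach`. [folklore] -/
theorem mem_treach {Z : TDom d N} {q : TPt d N} : q ∈ treach Z ↔ ∃ a ∈ Z.1, q = a ∨ TAdj a q := by
  classical
  simp [treach]

/-- Footprint-locality of the incompatibility through the reach (`B13Resummation.Geometry.loc`) on the torus. [folklore] -/
theorem tloc_of_touch {Z Z' : TDom d N} (h : TTouch Z' Z) : ∃ q ∈ treach Z, q ∈ Z'.1 := by
  obtain ⟨a, ha, b, hb, hab⟩ := h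
  refine ⟨a, mem_treach.2 ⟨b, hb, ?_⟩, ha⟩
  rcases hab with hab | hab
  · exact Or.inl hab
  · exact Or.inr hab.symm

/-- `#treach Z ≤ (2d + 1) · #cubes Z` on the torus (`B13Resummation.Geometry.reach_le` with ν = 2d + 1), from the
degree bound `tdegreeLE`. [folklore] -/
theorem card_treach_le (Z : TDom d N) :
    ((treach Z).card : ℝ) ≤ (2 * (d : ℝ) + 1) * (Z.1.card : ℝ) := by
  classical
  have hsub : treach Z ⊆ Z.1.biUnion fun a => insert a (tnbr a) := by
    intro q hq
    obtain ⟨a, ha, hqa⟩ := mem_treach.1 hq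
    rw [Finset.mem_biUnion]
    refine ⟨a, ha, ?_⟩
    rcases hqa with rfl | hqa
    · exact Finset.mem_insert_self _ _
    · exact Finset.mem_insert_of_mem (mem_tnbr.2 hqa)
  have h1 : (treach Z).card ≤ ∑ a ∈ Z.1, (insert a (tnbr a)).card :=
    (Finset.card_le_card hsub).trans Finset.card_biUnion_le
  have h2 : ∀ a ∈ Z.1, (insert a (tnbr a)).card ≤ 2 * d + 1 := fun a _ =>
    (Finset.card_insert_le _ _).trans
      (by have := tdegreeLE d N a; change (tnbr a).card ≤ 2 * d at this; omega)
  have h3 : (treach Z).card ≤ (2 * d + 1) * Z.1.card := by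
    refine h1.trans ?_
    rw [mul_comm]
    exact Finset.sum_le_card_nsmul _ _ _ h2 |>.trans (by simp [smul_eq_mul])
  have h4 : ((treach Z).card : ℝ) ≤ (((2 * d + 1) * Z.1.card : ℕ) : ℝ) := by exact_mod_cast h3
  simpa using h4

/-- (2.27) with its printed constant 5 for the COVERING FAMILIES of the torus catalogue
(`B13Resummation.Geometry.ineq227`), from `ineq227_torusTreeLen`: for every torus localization domain X̄ and every
family 𝐃 of torus localization domains whose cubes cover exactly the cubes of X̄, d_k(X̄) + 5 ≤ Σ_{Y∈𝐃}(d_k(Y) + 5);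
window version `TreeLengthCubeSystem.ineq227_cells`. [cite: Balaban1988RG2Cluster, (2.27) p.18] -/
theorem ineq227_tcubes (d N : ℕ) [NeZero N] (X : TDom d N) :
    B13FamilySum.Ineq227 (Finset.univ : Finset (tsys d N).Dom) (fun Y : TDom d N => Y.1) (tsys d N).dj
      X.1 (torusTreeLen X.1) 5 := by
  classical
  intro D hD
  rw [B13FamilySum.mem_coveringFamilies] at hD
  obtain ⟨-, hU⟩ := hD
  set D' : Finset (Finset (TPt d N)) := D.image (fun Y : TDom d N => Y.1) with hD'
  have hUnion : D'.biUnion id = X.1 := by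
    rw [← hU]
    ext c
    simp only [hD', Finset.mem_biUnion, Finset.mem_image, id]
    constructor
    · rintro ⟨Y, ⟨Z, hZ, rfl⟩, hc⟩
      exact ⟨Z, hZ, hc⟩
    · rintro ⟨Z, hZ, hc⟩
      exact ⟨Z.1, ⟨Z, hZ, rfl⟩, hc⟩
  have hDne : D.Nonempty := by
    obtain ⟨x, hx⟩ := X.2.1
    have hc : x ∈ D.biUnion (fun Y : TDom d N => Y.1) := by rw [hU]; exact hx
    obtain ⟨Y, hY, -⟩ := Finset.mem_biUnion.1 hc
    exact ⟨Y, hY⟩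
  have hD'ne : D'.Nonempty := hDne.image _
  have hmem : ∀ Y ∈ D', Y.Nonempty ∧ TFaceConnected Y := by
    intro Y hY
    obtain ⟨Z, _, rfl⟩ := Finset.mem_image.1 hY
    exact ⟨Z.2.1, Z.2.2⟩
  have hUc : TFaceConnected (D'.biUnion id) := by rw [hUnion]; exact X.2.2
  have h := ineq227_torusTreeLen hD'ne hmem hUc
  rw [hUnion] at h
  have hinj : ∀ Z ∈ D, ∀ W ∈ D, (fun Y : TDom d N => Y.1) Z = (fun Y : TDom d N => Y.1) W → Z = W :=
    fun Z _ W _ hZW => Subtype.ext hZW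
  have hsum : ∑ Y ∈ D', (torusTreeLen Y + 5) = ∑ Y ∈ D, (torusTreeLen Y.1 + 5) := by
    rw [hD']
    exact Finset.sum_image hinj
  rw [hsum] at h
  simpa using h

/-- **THE POLYMER GEOMETRY OF 𝐃_{k+1} ON THE TORUS, CONSTRUCTED** (`B13Resummation.Geometry`, unit pv18's HYPOTHESIS
structure of the G-B13-11 kernel — *"an instance is to be constructed by the joiner from the concrete lattice
geometry"*): for the torus catalogue `tsys d N` with cubes `TPt d N`, footprints = the members, incompatibility =
`TTouch`, reach = `treach`, ν = 2d + 1, κ₀ = κ₀(4·2^d, 2d), K₀ = K₀(4·2^d, 2d), c₁ = 4·2^d, and ALL its inequality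
fields — (1.26) at rate κ₀ (`tdegreeLE`, `tvolumeLeaf`, unit pv03's `familySum_ineq126_of_volumeLeaf`), the additive
volume bound, (2.27) with constant 5 (`ineq227_tcubes`) — PROVED.  Consequently
`B13Resummation.cammarotaStepWith_of_KP S c ℓ (tgeometry d N)` (for step data with 𝐃_{k+1} = `tsys d N`, the
periodic carrier of the papers) retains only its analytic hypotheses (`SpRestr`, `Repr213`) and numerical smallness
conditions; window version `TreeLengthCubeSystem.geometry`. [cite: Balaban1988RG2Cluster, (2.11) p.14] -/
def tgeometry (d N : ℕ) [NeZero N] : B13Resummation.Geometry (tsys d N) (TPt d N) where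
  cubes := fun X => X.1
  reach := treach
  ι := TTouch
  ν := 2 * (d : ℝ) + 1
  κ₀ := kappa₀ (4 * 2 ^ d) (2 * d)
  K₀ := B12TreeDecay.K₀ (4 * 2 ^ d) (2 * d)
  c₁ := 4 * 2 ^ d
  cubes_nonempty := fun X => X.2.1
  ι_refl := ttouch_refl
  ι_symm := ttouch_symm
  loc := fun _ _ h => tloc_of_touch h
  reach_le := card_treach_le
  ν_nonneg := by positivity
  κ₀_nonneg := kappa₀_nonneg (by positivity) _
  K₀_nonneg := (K₀_pos _ _).le
  c₁_nonneg := by positivity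
  ineq126 := familySum_ineq126_of_volumeLeaf (tcubeSys d N) (tdegreeLE d N) (tvolumeLeaf d N) le_rfl
  volBound := (familySum_volBound_iff (tcubeSys d N) _).2 (tvolumeLeaf d N)
  ineq227 := ineq227_tcubes d N

/-- The footprints of the torus geometry are the members of the domains. [folklore] -/
@[simp] theorem tgeometry_cubes (d N : ℕ) [NeZero N] (X : (tsys d N).Dom) : (tgeometry d N).cubes X = X.1 := rfl

/-- The constants of the torus geometry (for the smallness conditions of `B13Resummation.cammarotaStepWith_of_KP`):
ν = 2d + 1, κ₀ = κ₀(4·2^d, 2d), K₀ = K₀(4·2^d, 2d), c₁ = 4·2^d — the same as the window model's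
(`TreeLengthCubeSystem.geometry_consts`). [folklore] -/
theorem tgeometry_consts (d N : ℕ) [NeZero N] :
    (tgeometry d N).ν = 2 * (d : ℝ) + 1 ∧ (tgeometry d N).κ₀ = kappa₀ (4 * 2 ^ d) (2 * d) ∧
      (tgeometry d N).K₀ = B12TreeDecay.K₀ (4 * 2 ^ d) (2 * d) ∧ (tgeometry d N).c₁ = 4 * 2 ^ d :=
  ⟨rfl, rfl, rfl, rfl⟩

/-- d = 4: the torus geometry has ν = 9, κ₀ = 64 log 162, K₀ = K₀(64, 8), c₁ = 64
(`TreeLengthCubeSystem.kappa₀_four`). [folklore] -/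
theorem tgeometry_consts_four (N : ℕ) [NeZero N] :
    (tgeometry 4 N).ν = 9 ∧ (tgeometry 4 N).κ₀ = 64 * Real.log 162 ∧ (tgeometry 4 N).c₁ = 64 := by
  refine ⟨?_, ?_, ?_⟩
  · show 2 * ((4 : ℕ) : ℝ) + 1 = 9
    norm_num
  · show kappa₀ (4 * 2 ^ 4) (2 * 4) = 64 * Real.log 162
    exact TreeLengthCubeSystem.kappa₀_four
  · show (4 : ℝ) * 2 ^ 4 = 64
    norm_num

/-! ## Part 5. §2's closing chain of [Balaban1988RG2Cluster] ON THE TORUS — no geometry hypothesis -/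

/-- STEP DATA OVER THE TORUS: the carrier `B13.StepData` with its system of (k+1)-localization domains FIXED to be the
periodic system of the papers — 𝐃_{k+1} := the non-empty torus-face-connected families of cubes of the periodic array
of N^d cubes ([Balaban1987RG1] p. 251 torus, p. 257 localization domains, as formalised in `…TreeLengthTorus.tsys`),
d_{k+1} := `torusTreeLen`.  All other fields are those of `B13.StepData` verbatim; the window version is
`B13Closing.WindowStep` (unit b13 gen 3). [cite: Balaban1988RG2Cluster, (1.1)–(2.13) pp.3–14 (carrier)] -/
structure TorusStep (d N : ℕ) [NeZero N] where
  Dk : LocDomainSys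
  volk : Dk.Dom → ℕ
  Φ : Type
  Bond : Type
  [finBond : Fintype Bond]
  sp1 : Dk.Dom → Set Φ
  sp2 : (tsys d N).Dom → Set Φ
  Bv : Φ → Bond → ℂ
  Vp : Dk.Dom → Φ → ℂ
  V : Dk.Dom → Φ → ℂ
  Q : Dk.Dom → Φ → Bond → Bond → ℂ
  Vpp : Dk.Dom → Φ → ℂ
  H : (tsys d N).Dom → Φ → ℂ
  Ek1 : (tsys d N).Dom → Φ → ℂ
  Elog : (tsys d N).Dom → Φ → ℂ
  Analytic : (Φ → ℂ) → Set Φ → Prop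
  GaugeInv : (Φ → ℂ) → Prop
  Repr17 : Prop
  Restr : Prop

namespace TorusStep

variable {d N : ℕ} [NeZero N]

/-- The torus step data as abstract step data (`Dk1 := tsys d N`). [folklore] -/
def toStepData (W : TorusStep d N) : B13.StepData where
  Dk := W.Dk
  Dk1 := tsys d N
  volk := W.volk
  Φ := W.Φ
  Bond := W.Bond
  finBond := W.finBond
  sp1 := W.sp1
  sp2 := W.sp2
  Bv := W.Bv
  Vp := W.Vp
  V := W.V
  Q := W.Q
  Vpp := W.Vpp
  H := W.H
  Ek1 := W.Ek1
  Elog := W.Elog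
  Analytic := W.Analytic
  GaugeInv := W.GaugeInv
  Repr17 := W.Repr17
  Restr := W.Restr

/-- The (k+1)-system of torus step data is the torus system, definitionally. [folklore] -/
@[simp] theorem toStepData_Dk1 (W : TorusStep d N) : W.toStepData.Dk1 = tsys d N := rfl

/-- Hence the CONSTRUCTED polymer geometry of the torus serves torus step data: no geometry hypothesis is left.
[cite: Balaban1988RG2Cluster, (2.11) p.14] -/
def geom (W : TorusStep d N) : Geometry W.toStepData.Dk1 (TPt d N) := tgeometry d N

/-- The footprints of `geom` are the cubes of the domain. [folklore] -/
@[simp] theorem geom_cubes (W : TorusStep d N) (X : W.toStepData.Dk1.Dom) : W.geom.cubes X = X.1 := rfl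

/-- The restriction property of the spaces (p. 15, `B13Resummation.SpRestr`) for torus step data, from its form in the
printed words: a configuration in the space on X lies in the space on every domain Z ⊆ X. [cite: Balaban1988RG2Cluster, p.15] -/
theorem spRestr (W : TorusStep d N) (h : ∀ X Z : (tsys d N).Dom, ∀ φ, Z.1 ⊆ X.1 → φ ∈ W.sp2 X → φ ∈ W.sp2 Z) :
    SpRestr W.toStepData W.geom :=
  fun X Z φ hZX hφ => h X Z φ hZX hφ

open Classical in
/-- The representation (2.13) (`B13Resummation.Repr213`) for torus step data, from its concrete form: E^{(k+1)}(X, φ)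
is the X-localized part `locE` of log Ξ of the polymer gas on the torus with the incompatibility `TTouch` of (2.11)
and activities Z ↦ H(Z, φ). [cite: Balaban1988RG2Cluster, (2.13) p.14] -/
theorem repr213 (W : TorusStep d N)
    (h : ∀ X : (tsys d N).Dom, ∀ φ, φ ∈ W.sp2 X →
      W.Ek1 X φ = locE (TTouch (d := d) (N := N)) (fun Z : (tsys d N).Dom => Z.1) (fun Z => W.H Z φ) X.1) :
    Repr213 W.toStepData W.geom :=
  fun X φ hφ => h X φ hφ

end TorusStep

open TorusStep Classical in
/-- **§2's closing chain on the TORUS of [Balaban1987RG1] p. 251 — no geometry hypothesis.**  For step data whose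
𝐃_{k+1} is the periodic system (d_{k+1} := `torusTreeLen`), Theorem I.3's delivered clauses for A_{k+1}
(`B13.Deliverables`) follow from: the restrictions, Lemma 3_ℓ, the restriction property of the spaces (p. 15), the
representation (2.13) over the incompatibility *"Z ∩ Z′ contains a cube, or a wall of a cube"* of (2.11) ON THE
TORUS, the UNPRINTED per-cube log Z^{(k)} leaf `‖Elog(X)‖ ≤ B·#X·e^{−δ₀M·d_{k+1}(X)}`, (I.1.7) / analyticity / gauge
invariance, and the NUMBERS of `B13Closing.deliverables_window` — (1.26), (2.27), (2.29)/(2.30) being THEOREMS for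
`torusTreeLen` (this module and `…TreeLengthTorus`) and the [26]-step a THEOREM from Kotecký–Preiss (unit pv18).
`B13Closing.deliverables_of_KP_logHalf` (unit b13 gen 3) at G := `tgeometry d N`. [cite: Balaban1988RG2Cluster, pp.20–22 (Lemma 3 to Thm I.3)] -/
theorem deliverables_torus {d N : ℕ} [NeZero N] (W : TorusStep d N) (c : B13.Consts) {ℓ : ℝ}
    (hsp : ∀ X Z : (tsys d N).Dom, ∀ φ, Z.1 ⊆ X.1 → φ ∈ W.sp2 X → φ ∈ W.sp2 Z)
    (hrep : ∀ X : (tsys d N).Dom, ∀ φ, φ ∈ W.sp2 X →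
      W.Ek1 X φ = locE (TTouch (d := d) (N := N)) (fun Z : (tsys d N).Dom => Z.1) (fun Z => W.H Z φ) X.1)
    (hA : 0 ≤ c.C3act * c.ε₁) (hκ : 0 ≤ c.κ)
    (hlarge : c.κ + 2 * kappa₀ (4 * 2 ^ d) (2 * d) + 2 ≤ (1 - 8 * c.δ) * ℓ * c.κ)
    (hsmall : c.C3act * c.ε₁ * Real.exp (5 * c.κ + 1) * K₀ (4 * 2 ^ d) (2 * d) * (2 * (d : ℝ) + 1) *
      (4 * 2 ^ d) ≤ 1)
    (hA₂ : Real.exp 1 * (2 * (d : ℝ) + 1) * (4 * 2 ^ d) * K₀ (4 * 2 ^ d) (2 * d) ^ 2 ≤ c.A₂)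
    (hR : W.toStepData.Restr) (h3 : Lemma3With W.toStepData c ℓ) (h22 : c.R22gen ℓ) (h23 : c.R23)
    (h24 : c.R24sharp) (hE₀ : 0 ≤ c.E₀) {Bc : ℝ} (hB : 0 ≤ Bc)
    (hlog : LogHalfBound W.toStepData.Dk1 W.toStepData.sp2 W.toStepData.Elog (fun X => X.1.card) Bc (c.δ₀ * c.M))
    (hE₀def : Bc * (4 * 2 ^ d) ≤ c.E₀ / 2) (hrepr : W.toStepData.Repr17)
    (han : ∀ X, W.toStepData.Analytic (W.toStepData.Etot X) (W.toStepData.sp2 X))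
    (hg : ∀ X, W.toStepData.GaugeInv (W.toStepData.Etot X)) :
    Deliverables W.toStepData c :=
  deliverables_of_KP_logHalf W.toStepData c W.geom (W.spRestr hsp) (W.repr213 hrep) hA hκ hlarge hsmall hA₂ hR h3
    h22 h23 h24 hE₀ hB hlog hE₀def hrepr han hg

open TorusStep Classical in
/-- The papers' dimension d = 4 on the torus: the constants of `deliverables_torus` are κ₀ = 64 log 162
(`TreeLengthCubeSystem.kappa₀_four`), ν = 9, c₁ = 64, K₀ = K₀(64, 8) — the same numbers as the window's
(`B13Closing.deliverables_window_four`). [cite: Balaban1988RG2Cluster, pp.20–22 (Lemma 3 to Thm I.3)] -/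
theorem deliverables_torus_four {N : ℕ} [NeZero N] (W : TorusStep 4 N) (c : B13.Consts) {ℓ : ℝ}
    (hsp : ∀ X Z : (tsys 4 N).Dom, ∀ φ, Z.1 ⊆ X.1 → φ ∈ W.sp2 X → φ ∈ W.sp2 Z)
    (hrep : ∀ X : (tsys 4 N).Dom, ∀ φ, φ ∈ W.sp2 X →
      W.Ek1 X φ = locE (TTouch (d := 4) (N := N)) (fun Z : (tsys 4 N).Dom => Z.1) (fun Z => W.H Z φ) X.1)
    (hA : 0 ≤ c.C3act * c.ε₁) (hκ : 0 ≤ c.κ)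
    (hlarge : c.κ + 2 * (64 * Real.log 162) + 2 ≤ (1 - 8 * c.δ) * ℓ * c.κ)
    (hsmall : c.C3act * c.ε₁ * Real.exp (5 * c.κ + 1) * K₀ 64 8 * 9 * 64 ≤ 1)
    (hA₂ : Real.exp 1 * 9 * 64 * K₀ 64 8 ^ 2 ≤ c.A₂)
    (hR : W.toStepData.Restr) (h3 : Lemma3With W.toStepData c ℓ) (h22 : c.R22gen ℓ) (h23 : c.R23)
    (h24 : c.R24sharp) (hE₀ : 0 ≤ c.E₀) {Bc : ℝ} (hB : 0 ≤ Bc)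
    (hlog : LogHalfBound W.toStepData.Dk1 W.toStepData.sp2 W.toStepData.Elog (fun X => X.1.card) Bc (c.δ₀ * c.M))
    (hE₀def : Bc * 64 ≤ c.E₀ / 2) (hrepr : W.toStepData.Repr17)
    (han : ∀ X, W.toStepData.Analytic (W.toStepData.Etot X) (W.toStepData.sp2 X))
    (hg : ∀ X, W.toStepData.GaugeInv (W.toStepData.Etot X)) :
    Deliverables W.toStepData c := by
  have hκ₀ : kappa₀ (4 * 2 ^ 4) (2 * 4) = 64 * Real.log 162 := TreeLengthCubeSystem.kappa₀_four
  have h64 : (4 : ℝ) * 2 ^ 4 = 64 := by norm_num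
  have h9 : 2 * ((4 : ℕ) : ℝ) + 1 = 9 := by norm_num
  have hK : K₀ (4 * 2 ^ 4) (2 * 4) = K₀ 64 8 := by norm_num
  refine deliverables_torus W c hsp hrep hA hκ ?_ ?_ ?_ hR h3 h22 h23 h24 hE₀ hB hlog ?_ hrepr han hg
  · rw [hκ₀]; exact hlarge
  · rw [hK, h9, h64]; exact hsmall
  · rw [hK, h9, h64]; exact hA₂
  · rw [h64]; exact hE₀def

end Periodic

end

end Literature.MathematicalPhysics.QuantumFieldTheory.Balaban1983to89.TreeLengthTorusGeometry
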